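import Summits.CriticalPhenomena.PercolationContinuityZ3.Theorems.PercNearOneGluingNoHeavyRsw3InvasionFreshLabels
import Mathlib.Analysis.PSeries
import HarnessLib

/-!
# RSW3 lane (P2, gen 27): INVASION PERCOLATION XV — CHAYES–CHAYES–NEWMAN's PROPOSITION 2.1: THE CHECKED LABELS ARE
# ASYMPTOTICALLY UNIFORM, almost surely, and CCN's Corollary `limsup (Q_n(y) − Q_n(x)) ≤ Δ (y − x)`

builds on p205010 (kernel theorem, internal audit signed; external expert review pending) — NOT used in this file.

Cell `prim-rsw3`, prover seat `prim-rsw3-p2` (gen 27), memo `run/shared/lean/prim/rsw3/P2-RSWLITE.md` §34.  Support file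
(`--supports stmt-CriticalPhenomena-4575`); no definitions, no named facts, no sorries.  Notation as in file XIV: `E(I_n)` = edges incident to the
invaded region (`L_n = |E(I_n)|` = number of CHECKED labels), `D_n = Σ_{e ∈ E(I_n)} (𝟙{U_e ≤ y} − y)` the centred checked count at level `y`.

* **`integral_dev_sq_le`** — `E[D_n²] ≤ Δ²(n + 1)` on an infinite connected graph of degrees `≤ Δ` (file XIV's orthogonality, bounded increments).
* `labelMeasure_le_abs_dev_le` — Chebyshev: `μ{t ≤ |D_n|} ≤ Δ²(n + 1)/t²`.
* **`ae_eventually_abs_dev_le`** — for every `ε > 0`, almost surely `|D_n| ≤ ε (n + 1)` for all large `n` (Borel–Cantelli along the squares `n = m²`,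
  then the bounded increments `|D_{n+1} − D_n| ≤ Δ` in between).
* **`ae_tendsto_checkedFraction`** — **CCN's PROPOSITION 2.1 along the invasion: almost surely `#{e ∈ E(I_n) : U_e ≤ y} / L_n → y`** for every
  `y ∈ [0, 1]`, on every infinite connected graph of bounded degree (the labels the invasion EXAMINES are asymptotically uniformly distributed — it
  cannot bias what it sees, only what it accepts).
* **`ae_eventually_card_filter_acceptedLabel_mem_Ioc_le`** — CCN's COROLLARY: for `0 ≤ x ≤ y ≤ 1` and `ε > 0`, almost surely
  `#{k ≤ n : x_k ∈ (x, y]} ≤ (Δ (y − x) + ε)(n + 1)` for all large `n` (CCN: `limsup |Q_n(x) − Q_n(y)| ≤ (2d − 1)|x − y|`; here with the cruder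
  constant `Δ = 2d` from `L_n ≤ Δ(n+1)`); `…_zd` — the `ℤ^d` instance.

References: J. T. Chayes, L. Chayes, C. M. Newman, Comm. Math. Phys. 101 (1985) 383–407, Prop. 2.1 and its Corollary (2.6) [ChayesChayesNewman1985].
-/

noncomputable section

namespace Summit.CriticalPhenomena.PercolationContinuityZ3.Theorems.Rsw3

open Finset MeasureTheory ProbabilityTheory Filter Topology Literature.Probability.Percolation Literature.Probability.Percolation.Invasion
open scoped ENNReal

variable {V : Type*} [DecidableEq V] {G : SimpleGraph V} [G.LocallyFinite] [Countable V]

/-! ## §1 The second moment of the centred checked count grows at most linearly -/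

omit [Countable V] in
/-- The centred checked count is bounded: `|D_n| ≤ |E(I_n)| ≤ Δ(n+1)` on an infinite connected graph of degrees `≤ Δ`. [folklore] -/
theorem abs_dev_le [Infinite V] (hG : G.Preconnected) {Δ : ℕ} (hΔ : ∀ v, G.degree v ≤ Δ) (o : V) (n : ℕ) {y : ℝ}
    (hy0 : 0 ≤ y) (hy1 : y ≤ 1) (U : Sym2 V → ℝ) :
    |∑ e ∈ (invasion G U o n).biUnion (fun v => G.incidenceFinset v), ((if U e ≤ y then (1 : ℝ) else 0) - y)| ≤ Δ * (n + 1) := by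
  refine (abs_sum_indicator_sub_le_card hy0 hy1 _ U).trans ?_
  have h := card_biUnion_incidenceFinset_le hΔ (invasion G U o n)
  rw [card_invasion hG U o n] at h
  exact_mod_cast h

/-- Measurability of `U ↦ D_n(U)` (a finite sum over the possible regions). [folklore] -/
theorem measurable_dev (o : V) (n : ℕ) (y : ℝ) :
    Measurable fun U : Sym2 V → ℝ =>
      ∑ e ∈ (invasion G U o n).biUnion (fun v => G.incidenceFinset v), ((if U e ≤ y then (1 : ℝ) else 0) - y) := by
  obtain ⟨F, hF⟩ := exists_finset_forall_invasion_mem (G := G) o n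
  have heq : (fun U : Sym2 V → ℝ =>
      ∑ e ∈ (invasion G U o n).biUnion (fun v => G.incidenceFinset v), ((if U e ≤ y then (1 : ℝ) else 0) - y))
      = fun U => ∑ S ∈ F, if invasion G U o n = S then
          ∑ e ∈ S.biUnion (fun v => G.incidenceFinset v), ((if U e ≤ y then (1 : ℝ) else 0) - y) else 0 := by
    funext U
    rw [sum_ite_eq_of_mem F (invasion G U o n)
      (fun S => ∑ e ∈ S.biUnion (fun v => G.incidenceFinset v), ((if U e ≤ y then (1 : ℝ) else 0) - y)) (hF U)]
  rw [heq]
  refine Finset.measurable_sum _ fun S _ => Measurable.ite ?_ (measurable_sum_indicator_sub _ y) measurable_const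
  exact measurableSet_setOf.2 (measurable_invasion_eq o n S)

/-- **SECOND-MOMENT FORM OF CCN's PROPOSITION 2.1: `E[D_n²] ≤ Δ²(n + 1)`** on an infinite connected graph of degrees `≤ Δ` (`0 ≤ y ≤ 1`):
`D_{n+1}² = D_n² + 2D_n(D_{n+1} − D_n) + (D_{n+1} − D_n)²`, the cross term integrates to `0` (orthogonality) and the increment is bounded by `Δ`.
[cite: ChayesChayesNewman1985, Prop. 2.1] -/
theorem integral_dev_sq_le [Infinite V] (hG : G.Preconnected) {Δ : ℕ} (hΔ : ∀ v, G.degree v ≤ Δ) (o : V) {y : ℝ}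
    (hy0 : 0 ≤ y) (hy1 : y ≤ 1) (n : ℕ) :
    ∫ U, (∑ e ∈ (invasion G U o n).biUnion (fun v => G.incidenceFinset v), ((if U e ≤ y then (1 : ℝ) else 0) - y)) ^ 2
      ∂(labelMeasure V) ≤ (Δ : ℝ) ^ 2 * (n + 1) := by
  haveI : IsProbabilityMeasure (labelMeasure V) := isProbabilityMeasure_labelMeasure _
  -- abbreviations
  set D : ℕ → (Sym2 V → ℝ) → ℝ := fun n U =>
    ∑ e ∈ (invasion G U o n).biUnion (fun v => G.incidenceFinset v), ((if U e ≤ y then (1 : ℝ) else 0) - y) with hD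
  have hDm : ∀ n, Measurable (D n) := fun n => measurable_dev o n y
  have hDb : ∀ n U, |D n U| ≤ Δ * (n + 1) := fun n U => abs_dev_le hG hΔ o n hy0 hy1 U
  have hDint : ∀ n, Integrable (fun U => (D n U) ^ 2) (labelMeasure V) := fun n =>
    (memLp_top_of_bound ((hDm n).pow_const 2).aestronglyMeasurable (((Δ : ℝ) * (n + 1)) ^ 2)
      (Eventually.of_forall fun U => by
        rw [Real.norm_eq_abs, abs_pow]; exact pow_le_pow_left₀ (abs_nonneg _) (hDb n U) 2)).integrable le_top
  have hincr : ∀ n U, |D (n + 1) U - D n U| ≤ Δ := by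
    intro n U
    obtain ⟨a, ha⟩ := exists_newDart_eq_some (U := U) (boundaryDarts_invasion_nonempty hG U o n)
    simp only [hD]
    rw [sum_incidence_invasion_succ ha, add_sub_cancel_left]
    refine (abs_sum_indicator_sub_le_card hy0 hy1 _ U).trans ?_
    have : (G.incidenceFinset a.2 \ (invasion G U o n).biUnion fun v => G.incidenceFinset v).card ≤ Δ :=
      (card_le_card sdiff_subset).trans (by rw [SimpleGraph.card_incidenceFinset_eq_degree]; exact hΔ _)
    exact_mod_cast this
  change ∫ U, (D n U) ^ 2 ∂(labelMeasure V) ≤ (Δ : ℝ) ^ 2 * (n + 1)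
  induction n with
  | zero =>
    calc ∫ U, (D 0 U) ^ 2 ∂(labelMeasure V) ≤ ∫ _U, ((Δ : ℝ) * (0 + 1)) ^ 2 ∂(labelMeasure V) := by
          refine integral_mono (hDint 0) (integrable_const _) fun U => ?_
          have := hDb 0 U
          simp only [Nat.cast_zero] at this
          calc (D 0 U) ^ 2 = |D 0 U| ^ 2 := (sq_abs _).symm
            _ ≤ _ := pow_le_pow_left₀ (abs_nonneg _) this 2
      _ = (Δ : ℝ) ^ 2 * ((0 : ℕ) + 1) := by simp
  | succ n ih =>
    have hcross : ∫ U, D n U * (D (n + 1) U - D n U) ∂(labelMeasure V) = 0 :=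
      integral_dev_mul_increment_eq_zero hG o n hy0 hy1
    have hmI : Measurable fun U => D (n + 1) U - D n U := (hDm (n + 1)).sub (hDm n)
    have hIint : Integrable (fun U => (D (n + 1) U - D n U) ^ 2) (labelMeasure V) :=
      (memLp_top_of_bound (hmI.pow_const 2).aestronglyMeasurable ((Δ : ℝ) ^ 2)
        (Eventually.of_forall fun U => by
          show ‖(D (n + 1) U - D n U) ^ 2‖ ≤ (Δ : ℝ) ^ 2
          rw [Real.norm_eq_abs, abs_pow]; exact pow_le_pow_left₀ (abs_nonneg _) (hincr n U) 2)).integrable le_top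
    have hmC : Measurable fun U => D n U * (D (n + 1) U - D n U) := (hDm n).mul hmI
    have hCint : Integrable (fun U => D n U * (D (n + 1) U - D n U)) (labelMeasure V) :=
      (memLp_top_of_bound hmC.aestronglyMeasurable ((Δ : ℝ) * (n + 1) * Δ)
        (Eventually.of_forall fun U => by
          show ‖D n U * (D (n + 1) U - D n U)‖ ≤ (Δ : ℝ) * (n + 1) * Δ
          rw [Real.norm_eq_abs, abs_mul]
          exact mul_le_mul (hDb n U) (hincr n U) (abs_nonneg _) (by positivity))).integrable le_top
    have hexp : ∀ U, (D (n + 1) U) ^ 2 = (D n U) ^ 2 + 2 * (D n U * (D (n + 1) U - D n U)) + (D (n + 1) U - D n U) ^ 2 := by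
      intro U; ring
    simp_rw [hexp]
    have hC2 : Integrable (fun U => 2 * (D n U * (D (n + 1) U - D n U))) (labelMeasure V) := hCint.const_mul 2
    have hA : Integrable (fun U => (D n U) ^ 2 + 2 * (D n U * (D (n + 1) U - D n U))) (labelMeasure V) := (hDint n).add hC2
    rw [integral_add hA hIint, integral_add (hDint n) hC2, integral_const_mul, hcross, mul_zero, add_zero]
    have hI2 : ∫ U, (D (n + 1) U - D n U) ^ 2 ∂(labelMeasure V) ≤ (Δ : ℝ) ^ 2 := by
      calc ∫ U, (D (n + 1) U - D n U) ^ 2 ∂(labelMeasure V) ≤ ∫ _U, (Δ : ℝ) ^ 2 ∂(labelMeasure V) :=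
            integral_mono hIint (integrable_const _) fun U =>
              (sq_abs (D (n + 1) U - D n U)).symm.trans_le (pow_le_pow_left₀ (abs_nonneg _) (hincr n U) 2)
        _ = (Δ : ℝ) ^ 2 := by simp
    calc ∫ U, (D n U) ^ 2 ∂(labelMeasure V) + ∫ U, (D (n + 1) U - D n U) ^ 2 ∂(labelMeasure V)
        ≤ (Δ : ℝ) ^ 2 * (n + 1) + (Δ : ℝ) ^ 2 := add_le_add ih hI2
      _ = (Δ : ℝ) ^ 2 * ((n + 1 : ℕ) + 1) := by push_cast; ring


/-! ## §2 Chebyshev and Borel–Cantelli: `D_n = o(n)` almost surely -/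

/-- **Chebyshev**: `μ{t ≤ |D_n|} ≤ Δ²(n + 1)/t²` for `t > 0`. [cite: ChayesChayesNewman1985, Prop. 2.1 (law of large numbers)] -/
theorem labelMeasure_real_le_abs_dev_le [Infinite V] (hG : G.Preconnected) {Δ : ℕ} (hΔ : ∀ v, G.degree v ≤ Δ) (o : V) {y : ℝ}
    (hy0 : 0 ≤ y) (hy1 : y ≤ 1) (n : ℕ) {t : ℝ} (ht : 0 < t) :
    (labelMeasure V).real {U | t ≤ |∑ e ∈ (invasion G U o n).biUnion (fun v => G.incidenceFinset v), ((if U e ≤ y then (1 : ℝ) else 0) - y)|}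
      ≤ (Δ : ℝ) ^ 2 * (n + 1) / t ^ 2 := by
  haveI : IsProbabilityMeasure (labelMeasure V) := isProbabilityMeasure_labelMeasure _
  set D : (Sym2 V → ℝ) → ℝ := fun U =>
    ∑ e ∈ (invasion G U o n).biUnion (fun v => G.incidenceFinset v), ((if U e ≤ y then (1 : ℝ) else 0) - y) with hD
  have hDm : Measurable D := measurable_dev o n y
  have hDint : Integrable (fun U => (D U) ^ 2) (labelMeasure V) :=
    (memLp_top_of_bound (hDm.pow_const 2).aestronglyMeasurable (((Δ : ℝ) * (n + 1)) ^ 2)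
      (Eventually.of_forall fun U => by
        rw [Real.norm_eq_abs, abs_pow]; exact pow_le_pow_left₀ (abs_nonneg _) (abs_dev_le hG hΔ o n hy0 hy1 U) 2)).integrable le_top
  have hcheb := mul_meas_ge_le_integral_of_nonneg (Eventually.of_forall fun U => sq_nonneg (D U)) hDint (t ^ 2)
  have hsub : {U | t ≤ |D U|} ⊆ {U | t ^ 2 ≤ (D U) ^ 2} := fun U (hU : t ≤ |D U|) => by
    show t ^ 2 ≤ (D U) ^ 2
    rw [← sq_abs (D U)]; exact pow_le_pow_left₀ ht.le hU 2
  have h2 := integral_dev_sq_le hG hΔ o hy0 hy1 n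
  rw [le_div_iff₀ (by positivity)]
  calc (labelMeasure V).real {U | t ≤ |D U|} * t ^ 2 ≤ (labelMeasure V).real {U | t ^ 2 ≤ (D U) ^ 2} * t ^ 2 :=
        mul_le_mul_of_nonneg_right (measureReal_mono hsub (measure_ne_top (labelMeasure V) _)) (by positivity)
    _ ≤ (Δ : ℝ) ^ 2 * (n + 1) := by rw [mul_comm]; exact hcheb.trans h2

omit [Countable V] in
/-- Bounded increments: `|D_{n+k} − D_n| ≤ Δ k`. [cite: ChayesChayesNewman1985, §2 (0 ≤ R_n ≤ 2d − 1)] -/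
theorem abs_dev_sub_dev_le [Infinite V] (hG : G.Preconnected) {Δ : ℕ} (hΔ : ∀ v, G.degree v ≤ Δ) (o : V) {y : ℝ}
    (hy0 : 0 ≤ y) (hy1 : y ≤ 1) (U : Sym2 V → ℝ) (n : ℕ) :
    ∀ k : ℕ, |(∑ e ∈ (invasion G U o (n + k)).biUnion (fun v => G.incidenceFinset v), ((if U e ≤ y then (1 : ℝ) else 0) - y))
        - ∑ e ∈ (invasion G U o n).biUnion (fun v => G.incidenceFinset v), ((if U e ≤ y then (1 : ℝ) else 0) - y)| ≤ Δ * k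
  | 0 => by simp
  | k + 1 => by
    have ih := abs_dev_sub_dev_le hG hΔ o hy0 hy1 U n k
    obtain ⟨a, ha⟩ := exists_newDart_eq_some (U := U) (boundaryDarts_invasion_nonempty hG U o (n + k))
    rw [← add_assoc, sum_incidence_invasion_succ ha]
    have hstep : |∑ e ∈ G.incidenceFinset a.2 \ (invasion G U o (n + k)).biUnion (fun v => G.incidenceFinset v),
        ((if U e ≤ y then (1 : ℝ) else 0) - y)| ≤ Δ := by
      refine (abs_sum_indicator_sub_le_card hy0 hy1 _ U).trans ?_
      have : (G.incidenceFinset a.2 \ (invasion G U o (n + k)).biUnion fun v => G.incidenceFinset v).card ≤ Δ :=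
        (card_le_card sdiff_subset).trans (by rw [SimpleGraph.card_incidenceFinset_eq_degree]; exact hΔ _)
      exact_mod_cast this
    calc _ = |((∑ e ∈ (invasion G U o (n + k)).biUnion (fun v => G.incidenceFinset v), ((if U e ≤ y then (1 : ℝ) else 0) - y))
          - ∑ e ∈ (invasion G U o n).biUnion (fun v => G.incidenceFinset v), ((if U e ≤ y then (1 : ℝ) else 0) - y))
          + ∑ e ∈ G.incidenceFinset a.2 \ (invasion G U o (n + k)).biUnion (fun v => G.incidenceFinset v),
              ((if U e ≤ y then (1 : ℝ) else 0) - y)| := by rw [add_sub_right_comm]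
      _ ≤ Δ * k + Δ := (abs_add_le _ _).trans (add_le_add ih hstep)
      _ = Δ * ((k + 1 : ℕ) : ℝ) := by push_cast; ring

/-- **`D_n = o(n)` ALMOST SURELY**: for every `ε > 0`, a.s. `|D_n| ≤ ε (n + 1)` for all large `n` (infinite connected graph of degrees `≤ Δ`,
`0 ≤ y ≤ 1`).  Borel–Cantelli along `n = m²` (`Σ_m Δ²/(ε² (m² + 1)) < ∞`) and the bounded increments in between.
[cite: ChayesChayesNewman1985, Prop. 2.1 ("a consequence of the standard law of large numbers")] -/
theorem ae_eventually_abs_dev_le [Infinite V] (hG : G.Preconnected) {Δ : ℕ} (hΔ : ∀ v, G.degree v ≤ Δ) (o : V) {y : ℝ}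
    (hy0 : 0 ≤ y) (hy1 : y ≤ 1) {ε : ℝ} (hε : 0 < ε) :
    ∀ᵐ U ∂(labelMeasure V), ∀ᶠ n : ℕ in atTop,
      |∑ e ∈ (invasion G U o n).biUnion (fun v => G.incidenceFinset v), ((if U e ≤ y then (1 : ℝ) else 0) - y)| ≤ ε * (n + 1) := by
  haveI : IsProbabilityMeasure (labelMeasure V) := isProbabilityMeasure_labelMeasure _
  set D : ℕ → (Sym2 V → ℝ) → ℝ := fun n U =>
    ∑ e ∈ (invasion G U o n).biUnion (fun v => G.incidenceFinset v), ((if U e ≤ y then (1 : ℝ) else 0) - y) with hD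
  -- Borel–Cantelli along the squares, at level `ε/2`
  set Bad : ℕ → Set (Sym2 V → ℝ) := fun m => {U | ε / 2 * ((m : ℝ) ^ 2 + 1) ≤ |D (m ^ 2) U|} with hBad
  have hbound : ∀ m : ℕ, labelMeasure V (Bad m) ≤ ENNReal.ofReal (8 * (Δ : ℝ) ^ 2 / ε ^ 2 * (1 / ((m : ℝ) + 1) ^ 2)) := by
    intro m
    have h := labelMeasure_real_le_abs_dev_le hG hΔ o hy0 hy1 (m ^ 2) (t := ε / 2 * ((m : ℝ) ^ 2 + 1)) (by positivity)
    rw [← ofReal_measureReal (measure_ne_top _ _)]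
    refine ENNReal.ofReal_le_ofReal (h.trans ?_)
    rw [Nat.cast_pow, div_le_iff₀ (by positivity)]
    have hm1 : ((m : ℝ) + 1) ^ 2 ≤ 2 * ((m : ℝ) ^ 2 + 1) := by nlinarith [sq_nonneg ((m : ℝ) - 1)]
    have hpos : (0 : ℝ) < ((m : ℝ) + 1) ^ 2 := by positivity
    -- `Δ²(m²+1) ≤ (8Δ²/ε²)(1/(m+1)²) (ε/2)²(m²+1)²`, i.e. `(m+1)² ≤ 2 (m²+1)`
    have : 8 * (Δ : ℝ) ^ 2 / ε ^ 2 * (1 / ((m : ℝ) + 1) ^ 2) * (ε / 2 * ((m : ℝ) ^ 2 + 1)) ^ 2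
        = (Δ : ℝ) ^ 2 * ((m : ℝ) ^ 2 + 1) * (2 * ((m : ℝ) ^ 2 + 1) / ((m : ℝ) + 1) ^ 2) := by
      field_simp; ring
    rw [this]
    have h1 : (1 : ℝ) ≤ 2 * ((m : ℝ) ^ 2 + 1) / ((m : ℝ) + 1) ^ 2 := by rw [le_div_iff₀ hpos]; linarith
    calc (Δ : ℝ) ^ 2 * ((m : ℝ) ^ 2 + 1) = (Δ : ℝ) ^ 2 * ((m : ℝ) ^ 2 + 1) * 1 := (mul_one _).symm
      _ ≤ _ := by gcongr
  have hsum : ∑' m, labelMeasure V (Bad m) ≠ ∞ := by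
    have hs : Summable fun m : ℕ => 8 * (Δ : ℝ) ^ 2 / ε ^ 2 * (1 / ((m : ℝ) + 1) ^ 2) := by
      have h1 : Summable fun m : ℕ => 1 / (((m + 1 : ℕ) : ℝ)) ^ 2 :=
        (summable_nat_add_iff 1).2 (Real.summable_one_div_nat_pow.2 one_lt_two)
      refine (h1.mul_left (8 * (Δ : ℝ) ^ 2 / ε ^ 2)).congr fun m => ?_
      push_cast; ring
    refine ne_top_of_le_ne_top ?_ (ENNReal.tsum_le_tsum hbound)
    rw [← ENNReal.ofReal_tsum_of_nonneg (fun m => by positivity) hs]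
    exact ENNReal.ofReal_ne_top
  filter_upwards [ae_eventually_notMem hsum] with U hU
  -- from the squares to all `n`
  obtain ⟨M₁, hM₁⟩ := eventually_atTop.1 hU
  obtain ⟨M₂, hM₂⟩ := exists_nat_ge (4 * (Δ : ℝ) / ε)
  refine eventually_atTop.2 ⟨(max M₁ M₂) ^ 2, fun n hn => ?_⟩
  set m := Nat.sqrt n with hm
  have hm1 : m ^ 2 ≤ n := Nat.sqrt_le' n
  have hm2 : n < (m + 1) ^ 2 := Nat.lt_succ_sqrt' n
  have hmM : max M₁ M₂ ≤ m := by
    rw [hm, Nat.le_sqrt']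
    exact hn
  have hgood : |D (m ^ 2) U| < ε / 2 * ((m : ℝ) ^ 2 + 1) := by
    have := hM₁ m (le_trans (le_max_left _ _) hmM)
    simp only [hBad, Set.mem_setOf_eq, not_le] at this
    exact this
  have hincr := abs_dev_sub_dev_le hG hΔ o hy0 hy1 U (m ^ 2) (n - m ^ 2)
  rw [Nat.add_sub_cancel' hm1] at hincr
  have hk : ((n - m ^ 2 : ℕ) : ℝ) ≤ 2 * m := by
    have : n - m ^ 2 ≤ 2 * m := by
      have h' : (m + 1) ^ 2 = m ^ 2 + 2 * m + 1 := by ring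
      omega
    exact_mod_cast this
  have hmR : 4 * (Δ : ℝ) / ε ≤ m := hM₂.trans (by exact_mod_cast le_trans (le_max_right _ _) hmM)
  have hΔm : (Δ : ℝ) * (2 * m) ≤ ε / 2 * ((m : ℝ) ^ 2 + 1) := by
    rw [div_le_iff₀ hε] at hmR
    nlinarith [sq_nonneg (m : ℝ), hε]
  have hn' : ((m : ℝ) ^ 2) ≤ n := by exact_mod_cast hm1
  calc |D n U| = |(D n U - D (m ^ 2) U) + D (m ^ 2) U| := by ring_nf
    _ ≤ |D n U - D (m ^ 2) U| + |D (m ^ 2) U| := abs_add_le _ _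
    _ ≤ Δ * ((n - m ^ 2 : ℕ) : ℝ) + ε / 2 * ((m : ℝ) ^ 2 + 1) := add_le_add hincr hgood.le
    _ ≤ Δ * (2 * m) + ε / 2 * ((m : ℝ) ^ 2 + 1) := by gcongr
    _ ≤ ε / 2 * ((m : ℝ) ^ 2 + 1) + ε / 2 * ((m : ℝ) ^ 2 + 1) := by gcongr
    _ = ε * ((m : ℝ) ^ 2 + 1) := by ring
    _ ≤ ε * (n + 1) := by gcongr

/-! ## §3 Proposition 2.1 along the invasion, and CCN's Corollary -/

omit [Countable V] in
/-- The number of checked labels is at least `n + 1`: `n + 1 ≤ L_n` (the edges absorbed at steps `0, …, n` are distinct checked edges — file X's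
injection with `J = univ`). [cite: ChayesChayesNewman1985, §2 (n ≤ L_n)] -/
theorem succ_le_card_biUnion_incidenceFinset_invasion [Infinite V] (hG : G.Preconnected) (U : Sym2 V → ℝ) (o : V) (n : ℕ) :
    n + 1 ≤ ((invasion G U o n).biUnion fun v => G.incidenceFinset v).card := by
  classical
  have h := card_filter_acceptedLabel_le_card_filter_incidence hG U o (Set.univ : Set ℝ) n
  simp only [Set.mem_univ, filter_true_of_mem, implies_true, card_range] at h
  exact h

/-- **CHAYES–CHAYES–NEWMAN's PROPOSITION 2.1 (along the invasion): the CHECKED labels are asymptotically uniform, almost surely** —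
`#{e ∈ E(I_n) : U_e ≤ y} / L_n → y` for every `y ∈ [0,1]`, on every infinite connected graph of degrees `≤ Δ`.
[cite: ChayesChayesNewman1985, Prop. 2.1 ("With probability one, P_n(y) → y")] -/
theorem ae_tendsto_checkedFraction [Infinite V] (hG : G.Preconnected) {Δ : ℕ} (hΔ : ∀ v, G.degree v ≤ Δ) (o : V) {y : ℝ}
    (hy0 : 0 ≤ y) (hy1 : y ≤ 1) :
    ∀ᵐ U ∂(labelMeasure V), Tendsto (fun n : ℕ =>
      ((((invasion G U o n).biUnion fun v => G.incidenceFinset v).filter fun e => U e ≤ y).card : ℝ)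
        / ((invasion G U o n).biUnion fun v => G.incidenceFinset v).card) atTop (𝓝 y) := by
  have hae := ae_all_iff.2 fun q : ℕ => ae_eventually_abs_dev_le hG hΔ o hy0 hy1 (ε := 1 / ((q : ℝ) + 1)) (by positivity)
  filter_upwards [hae] with U hU
  rw [Metric.tendsto_atTop]
  intro ε hε
  obtain ⟨q, hq⟩ := exists_nat_one_div_lt hε
  obtain ⟨N, hN⟩ := eventually_atTop.1 (hU q)
  refine ⟨N, fun n hn => ?_⟩
  set E := (invasion G U o n).biUnion fun v => G.incidenceFinset v with hE
  have hL : (n : ℝ) + 1 ≤ E.card := by exact_mod_cast succ_le_card_biUnion_incidenceFinset_invasion hG U o n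
  have hLpos : (0 : ℝ) < E.card := by linarith
  -- `#{checked ≤ y} − y·L_n = D_n`
  have hdev : ((E.filter fun e => U e ≤ y).card : ℝ) - y * E.card = ∑ e ∈ E, ((if U e ≤ y then (1 : ℝ) else 0) - y) := by
    rw [sum_sub_distrib, sum_const, nsmul_eq_mul, mul_comm]
    congr 1
    rw [← sum_boole]
  have hDn := hN n hn
  rw [Real.dist_eq]
  have : (((E.filter fun e => U e ≤ y).card : ℝ)) / E.card - y = (∑ e ∈ E, ((if U e ≤ y then (1 : ℝ) else 0) - y)) / E.card := by
    rw [← hdev, sub_div, mul_div_assoc, div_self hLpos.ne', mul_one]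
  rw [this, abs_div, abs_of_pos hLpos, div_lt_iff₀ hLpos]
  calc |∑ e ∈ E, ((if U e ≤ y then (1 : ℝ) else 0) - y)| ≤ 1 / ((q : ℝ) + 1) * (n + 1) := hDn
    _ < ε * (n + 1) := by gcongr
    _ ≤ ε * E.card := by gcongr

/-- **CCN's COROLLARY (Lipschitz bound on the empirical distribution of the ACCEPTED labels)**: for `0 ≤ x ≤ y ≤ 1` and `ε > 0`, almost surely
`#{k ≤ n : x_k ∈ (x, y]} ≤ (Δ (y − x) + ε)(n + 1)` for all large `n` — the number of values accepted in an interval is at most the number of values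
checked in it (file X), and the checked values are asymptotically uniform.  (CCN: `limsup |Q_n(x) − Q_n(y)| ≤ (2d − 1)|x − y|`; here with `Δ = 2d`
from `L_n ≤ Δ (n + 1)`.) [cite: ChayesChayesNewman1985, Corollary to Prop. 2.1, eq. (2.6)] -/
theorem ae_eventually_card_filter_acceptedLabel_mem_Ioc_le [Infinite V] (hG : G.Preconnected) {Δ : ℕ} (hΔ : ∀ v, G.degree v ≤ Δ) (o : V)
    {x y : ℝ} (hx0 : 0 ≤ x) (hxy : x ≤ y) (hy1 : y ≤ 1) {ε : ℝ} (hε : 0 < ε) :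
    ∀ᵐ U ∂(labelMeasure V), ∀ᶠ n : ℕ in atTop,
      (((Finset.range (n + 1)).filter fun k => acceptedLabel G U o k ∈ Set.Ioc x y).card : ℝ) ≤ (Δ * (y - x) + ε) * (n + 1) := by
  filter_upwards [ae_eventually_abs_dev_le hG hΔ o hx0 (hxy.trans hy1) (half_pos hε),
    ae_eventually_abs_dev_le hG hΔ o (hx0.trans hxy) hy1 (half_pos hε)] with U hUx hUy
  filter_upwards [hUx, hUy] with n hnx hny
  set E := (invasion G U o n).biUnion fun v => G.incidenceFinset v with hE
  have hL : (E.card : ℝ) ≤ Δ * (n + 1) := by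
    have h := card_biUnion_incidenceFinset_le hΔ (invasion G U o n)
    rw [card_invasion hG U o n] at h
    exact_mod_cast h
  -- accepted in (x, y] ≤ checked in (x, y] = #{≤ y} − #{≤ x}
  have h1 : ((Finset.range (n + 1)).filter fun k => acceptedLabel G U o k ∈ Set.Ioc x y).card
      ≤ (E.filter fun e => U e ∈ Set.Ioc x y).card :=
    card_filter_acceptedLabel_le_card_filter_incidence hG U o (Set.Ioc x y) n
  have h2 : ((E.filter fun e => U e ∈ Set.Ioc x y).card : ℝ)
      = (E.filter fun e => U e ≤ y).card - (E.filter fun e => U e ≤ x).card := by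
    have hsub : (E.filter fun e => U e ≤ x) ⊆ E.filter fun e => U e ≤ y :=
      fun e he => by rw [mem_filter] at he ⊢; exact ⟨he.1, he.2.trans hxy⟩
    have hsd : (E.filter fun e => U e ∈ Set.Ioc x y) = (E.filter fun e => U e ≤ y) \ E.filter fun e => U e ≤ x := by
      ext e; simp only [mem_filter, Finset.mem_sdiff, Set.mem_Ioc, not_and, not_le]
      constructor
      · rintro ⟨he, hxe, hey⟩; exact ⟨⟨he, hey⟩, fun _ => hxe⟩
      · rintro ⟨⟨he, hey⟩, h⟩; exact ⟨he, h he, hey⟩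
    rw [hsd, card_sdiff_of_subset hsub, Nat.cast_sub (card_le_card hsub)]
  have hdev : ∀ z : ℝ, ((E.filter fun e => U e ≤ z).card : ℝ) = z * E.card + ∑ e ∈ E, ((if U e ≤ z then (1 : ℝ) else 0) - z) := by
    intro z
    rw [sum_sub_distrib, sum_const, nsmul_eq_mul, mul_comm (E.card : ℝ) z, ← sum_boole]
    ring
  calc (((Finset.range (n + 1)).filter fun k => acceptedLabel G U o k ∈ Set.Ioc x y).card : ℝ)
      ≤ (E.filter fun e => U e ∈ Set.Ioc x y).card := by exact_mod_cast h1
    _ = (y - x) * E.card + (∑ e ∈ E, ((if U e ≤ y then (1 : ℝ) else 0) - y) - ∑ e ∈ E, ((if U e ≤ x then (1 : ℝ) else 0) - x)) := by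
        rw [h2, hdev y, hdev x]; ring
    _ ≤ (y - x) * (Δ * (n + 1)) + (ε / 2 * (n + 1) + ε / 2 * (n + 1)) := by
        gcongr
        exact (le_abs_self _).trans ((abs_sub _ _).trans (add_le_add hny hnx))
    _ = (Δ * (y - x) + ε) * (n + 1) := by ring

/-! ## §4 The `ℤ^d` instances -/

section Zd

open Literature.Probability.LatticeModels

variable {d : ℕ}

/-- **CCN's Proposition 2.1 on `ℤ^d`** (`d ≥ 1`, `y ∈ [0,1]`): almost surely the fraction of the labels checked by the invasion that are `≤ y` tends to `y`.
[cite: ChayesChayesNewman1985, Prop. 2.1] -/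
theorem ae_tendsto_checkedFraction_zd (hd : 1 ≤ d) {y : ℝ} (hy0 : 0 ≤ y) (hy1 : y ≤ 1) :
    ∀ᵐ U ∂(labelMeasure (Site d)), Tendsto (fun n : ℕ =>
      ((((invasion (zdGraph d) U 0 n).biUnion fun v => (zdGraph d).incidenceFinset v).filter fun e => U e ≤ y).card : ℝ)
        / ((invasion (zdGraph d) U 0 n).biUnion fun v => (zdGraph d).incidenceFinset v).card) atTop (𝓝 y) := by
  haveI : Nonempty (Fin d) := ⟨⟨0, hd⟩⟩
  haveI : Infinite (Site d) := Pi.infinite_of_right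
  have hΔ : ∀ v : Site d, (zdGraph d).degree v ≤ 2 * d := fun v => by
    rw [← SimpleGraph.card_neighborFinset_eq_degree, card_neighborFinset_zdGraph_holds v]
  exact ae_tendsto_checkedFraction zdGraph_preconnected_holds hΔ 0 hy0 hy1

/-- **CCN's Corollary on `ℤ^d`** (`d ≥ 1`, `0 ≤ x ≤ y ≤ 1`, `ε > 0`): almost surely `#{k ≤ n : x_k ∈ (x, y]} ≤ (2d (y − x) + ε)(n + 1)` for all large `n`.
[cite: ChayesChayesNewman1985, Corollary to Prop. 2.1, eq. (2.6)] -/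
theorem ae_eventually_card_filter_acceptedLabel_mem_Ioc_le_zd (hd : 1 ≤ d) {x y : ℝ} (hx0 : 0 ≤ x) (hxy : x ≤ y) (hy1 : y ≤ 1)
    {ε : ℝ} (hε : 0 < ε) :
    ∀ᵐ U ∂(labelMeasure (Site d)), ∀ᶠ n : ℕ in atTop,
      (((Finset.range (n + 1)).filter fun k => acceptedLabel (zdGraph d) U 0 k ∈ Set.Ioc x y).card : ℝ)
        ≤ ((2 * d : ℕ) * (y - x) + ε) * (n + 1) := by
  haveI : Nonempty (Fin d) := ⟨⟨0, hd⟩⟩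
  haveI : Infinite (Site d) := Pi.infinite_of_right
  have hΔ : ∀ v : Site d, (zdGraph d).degree v ≤ 2 * d := fun v => by
    rw [← SimpleGraph.card_neighborFinset_eq_degree, card_neighborFinset_zdGraph_holds v]
  exact ae_eventually_card_filter_acceptedLabel_mem_Ioc_le zdGraph_preconnected_holds hΔ 0 hx0 hxy hy1 hε

end Zd

end Summit.CriticalPhenomena.PercolationContinuityZ3.Theorems.Rsw3

end
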